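import Mathlib
import HarnessLib
import Literature.Geometry.DiscreteGeometry.KissingPatterns
import Summits.AtomisticToContinuum.Crystallization.Theorems.PricedLinkCensusSoftFourRingsDefs
import Summits.AtomisticToContinuum.Crystallization.Theorems.PricedLinkCensusSoftFourRingsRigCellSound2
import Summits.AtomisticToContinuum.Crystallization.Theorems.PricedLinkCensusSoftFourRingsRigModels
import Summits.AtomisticToContinuum.Crystallization.Theorems.PricedLinkCensusSoftFourRingsRigFrame

/-!
# Soft four-rings, metric half by certified numerics (10): from the checker to labelled closeness

Route `PricedLinkCensus`, sub-problem `Crystallization`, item `SoftFourRings`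
(stmt-AtomisticToContinuum-14234).  The geometric wrapper around `runCell_sound`:

* `coversChart_sound` — the cells of a chart cover every `y ∈ [−1, 1]`;
* `isometry_of_closeTo` — coordinates close to a rotated pattern give a linear isometry of `ℝ³`
  moving the pattern points `tab i/√N` close to the configuration;
* **`close_of_checkAll`** — if `checkAll m cells = true` (well-formed model), every labelled
  configuration of unit vectors obeying the one-percent windows of `m.bond` is, label by label,
  within `6/25` of the image of the pattern under a linear isometry of `ℝ³`;
* the two models are well formed, their pattern points enumerate `fccKissingPattern` /
  `hcpKissingPattern`, and so **`labelledRigidity_of_checkAll`**: `LabelledRigidity (6/25)`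
  (`…SoftFourRingsDefs`) follows from `checkAll fccModel cf = true` and `checkAll hcpModel ch = true`
  (discharged on the certificate data in `…RigMain`).
-/

namespace Summit.AtomisticToContinuum.Crystallization.Theorems

namespace Rig

open Literature.Analysis.ValidatedNumerics.NumericsMP Literature.Geometry.DiscreteGeometry
open scoped Matrix RealInnerProductSpace


/-! ### Coverage -/

/-- The chain step of `coversChart`. -/
def chainStep (acc : Option ℤ) (c : Cell) : Option ℤ :=
  match acc with
  | none => none
  | some hi => if c.tlo ≤ hi then some (max hi c.thi) else none

/-- A failed chain stays failed. -/
theorem foldl_chainStep_none : ∀ L : List Cell, L.foldl chainStep none = none := by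
  intro L; induction L with
  | nil => rfl
  | cons _ _ ih => simpa [chainStep] using ih

/-- Points beyond the current frontier are covered by the rest of a successful chain. -/
theorem chain_covers : ∀ (L : List Cell) (hi0 hi : ℤ), L.foldl chainStep (some hi0) = some hi →
    ∀ z : ℝ, (hi0 : ℝ) < z → z ≤ hi → ∃ c ∈ L, (c.tlo : ℝ) ≤ z ∧ z ≤ c.thi := by
  intro L
  induction L with
  | nil =>
    intro hi0 hi h z h1 h2
    simp only [List.foldl_nil, Option.some.injEq] at h
    subst h; linarith
  | cons c L ih =>
    intro hi0 hi h z h1 h2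
    simp only [List.foldl_cons] at h
    by_cases hle : c.tlo ≤ hi0
    · have hstep : chainStep (some hi0) c = some (max hi0 c.thi) := by simp [chainStep, hle]
      rw [hstep] at h
      by_cases hz : z ≤ c.thi
      · have : (c.tlo : ℝ) ≤ hi0 := by exact_mod_cast hle
        exact ⟨c, by simp, by linarith, hz⟩
      · push Not at hz
        have h1' : ((max hi0 c.thi : ℤ) : ℝ) < z := by push_cast; exact max_lt h1 hz
        obtain ⟨c', hc', h⟩ := ih _ _ h z h1' h2
        exact ⟨c', by simp [hc'], h⟩
    · have hstep : chainStep (some hi0) c = none := by simp [chainStep, hle]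
      rw [hstep, foldl_chainStep_none] at h
      exact absurd h (by simp)

/-- `coversChart` in terms of `chainStep`. -/
theorem coversChart_eq (cells : List Cell) (xp : Bool) :
    coversChart cells xp = (match cells.filter (fun c => c.xpos == xp) with
      | [] => false
      | c0 :: rest => decide (c0.tlo ≤ -(SC : ℤ)) &&
          (match rest.foldl chainStep (some c0.thi) with
           | none => false
           | some hi => decide ((SC : ℤ) ≤ hi))) := by
  rfl

/-- **Coverage**: if `coversChart cells xp` holds then every `y ∈ [−1, 1]` lies in a cell of
chart `xp`. -/
theorem coversChart_sound {cells : List Cell} {xp : Bool} (h : coversChart cells xp = true) (y : ℝ)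
    (hy1 : -1 ≤ y) (hy2 : y ≤ 1) :
    ∃ c ∈ cells, c.xpos = xp ∧ (c.tlo : ℝ) ≤ y * SC ∧ y * SC ≤ c.thi := by
  have hS : (0 : ℝ) < SC := by exact_mod_cast SC_pos
  rw [coversChart_eq] at h
  have hmem : ∀ c ∈ cells.filter (fun c => c.xpos == xp), c ∈ cells ∧ c.xpos = xp := by
    intro c hc; rw [List.mem_filter] at hc; exact ⟨hc.1, by simpa using hc.2⟩
  revert h hmem
  cases cells.filter (fun c => c.xpos == xp) with
  | nil => simp
  | cons c0 rest =>
    intro h hmem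
    simp only [Bool.and_eq_true, decide_eq_true_eq] at h
    obtain ⟨h0, h⟩ := h
    revert h
    cases hlast : rest.foldl chainStep (some c0.thi) with
    | none => simp
    | some hi =>
      intro h
      simp only [decide_eq_true_eq] at h
      by_cases hz : y * SC ≤ c0.thi
      · refine ⟨c0, (hmem c0 (by simp)).1, (hmem c0 (by simp)).2, ?_, hz⟩
        have : (c0.tlo : ℝ) ≤ -(SC : ℝ) := by exact_mod_cast h0
        nlinarith
      · push Not at hz
        have hle : y * SC ≤ hi := by
          have : (SC : ℝ) ≤ hi := by exact_mod_cast h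
          nlinarith
        obtain ⟨c, hc, h1, h2⟩ := chain_covers rest c0.thi hi hlast (y * SC) hz hle
        exact ⟨c, (hmem c (by simp [hc])).1, (hmem c (by simp [hc])).2, h1, h2⟩


/-! ### From `CloseTo` to a linear isometry -/

/-- The pattern point `tab i/√N` as a vector of `ℝ³`. -/
noncomputable def patPt (m : Model) (i : Fin 12) : EuclideanSpace ℝ (Fin 3) :=
  (Real.sqrt m.normSq)⁻¹ • intVec (m.tab i)

/-- Coordinates of the pattern point. -/
theorem patPt_apply (m : Model) (i : Fin 12) (l : Fin 3) :
    (patPt m i).ofLp l = (m.tab i l : ℝ) / Real.sqrt m.normSq := by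
  rw [patPt, WithLp.ofLp_smul, Pi.smul_apply, intVec_apply, smul_eq_mul]; ring

/-- An orthonormal basis of `ℝ³` from the columns of a matrix with orthonormal columns. -/
noncomputable def colBasis (R : Fin 3 → Fin 3 → ℝ)
    (hR : ∀ i j, (∑ k, R k i * R k j) = if i = j then 1 else 0) :
    OrthonormalBasis (Fin 3) ℝ (EuclideanSpace ℝ (Fin 3)) :=
  have hon : Orthonormal ℝ (fun l => (WithLp.toLp 2 (fun k => R k l) : EuclideanSpace ℝ (Fin 3))) := by
    rw [orthonormal_iff_ite]
    intro i j
    rw [EuclideanSpace.inner_eq_star_dotProduct, star_trivial, dotProduct_comm, WithLp.ofLp_toLp,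
      WithLp.ofLp_toLp, dotProduct]
    exact hR i j
  (basisOfOrthonormalOfCardEqFinrank hon (by simp)).toOrthonormalBasis
    (by rw [coe_basisOfOrthonormalOfCardEqFinrank]; exact hon)

/-- The column basis vectors. -/
theorem colBasis_apply (R : Fin 3 → Fin 3 → ℝ)
    (hR : ∀ i j, (∑ k, R k i * R k j) = if i = j then 1 else 0) (l : Fin 3) :
    colBasis R hR l = WithLp.toLp 2 (fun k => R k l) := by
  rw [colBasis, Module.Basis.coe_toOrthonormalBasis, coe_basisOfOrthonormalOfCardEqFinrank]

/-- `cB.repr.symm v` has coordinates `(R v)_k`. -/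
theorem colBasis_repr_symm_apply (R : Fin 3 → Fin 3 → ℝ)
    (hR : ∀ i j, (∑ k, R k i * R k j) = if i = j then 1 else 0) (v : EuclideanSpace ℝ (Fin 3))
    (k : Fin 3) :
    ((colBasis R hR).repr.symm v).ofLp k = ∑ l, R k l * v.ofLp l := by
  rw [← OrthonormalBasis.sum_repr_symm]
  rw [WithLp.ofLp_sum]
  simp only [WithLp.ofLp_smul, Finset.sum_apply, Pi.smul_apply, colBasis_apply, smul_eq_mul]
  refine Finset.sum_congr rfl fun l _ => ?_; ring

/-- **From `CloseTo` (for coordinates in an orthonormal basis) to a linear isometry.** -/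
theorem isometry_of_closeTo {m : Model} {p : Fin 12 → EuclideanSpace ℝ (Fin 3)}
    (bE : OrthonormalBasis (Fin 3) ℝ (EuclideanSpace ℝ (Fin 3)))
    (X : Fin 12 → Fin 3 → ℝ) (hX : ∀ i, bE.repr (p i) = WithLp.toLp 2 (X i))
    (hC : CloseTo m X) :
    ∃ A : EuclideanSpace ℝ (Fin 3) →ₗᵢ[ℝ] EuclideanSpace ℝ (Fin 3),
      ∀ i, dist (p i) (A (patPt m i)) ≤ 6 / 25 := by
  obtain ⟨R, hR, hdev⟩ := hC
  set cB := colBasis R hR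
  refine ⟨(cB.repr.symm.trans bE.repr.symm).toLinearIsometry, fun i => ?_⟩
  have hpi : p i = bE.repr.symm (WithLp.toLp 2 (X i)) := by
    rw [← hX i, LinearIsometryEquiv.symm_apply_apply]
  rw [LinearIsometryEquiv.coe_toLinearIsometry, LinearIsometryEquiv.trans_apply, hpi,
    LinearIsometryEquiv.dist_map, EuclideanSpace.dist_eq]
  have hsum : (∑ k, dist ((WithLp.toLp 2 (X i) : EuclideanSpace ℝ (Fin 3)).ofLp k)
      ((cB.repr.symm (patPt m i)).ofLp k) ^ 2) =
      ∑ k, (X i k - ∑ l, R k l * ((m.tab i l : ℝ) / Real.sqrt m.normSq)) ^ 2 := by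
    refine Finset.sum_congr rfl fun k _ => ?_
    rw [Real.dist_eq, sq_abs, WithLp.ofLp_toLp, colBasis_repr_symm_apply]
    congr 2
    refine Finset.sum_congr rfl fun l _ => ?_
    rw [patPt_apply]
  rw [hsum]
  calc Real.sqrt (∑ k, (X i k - ∑ l, R k l * ((m.tab i l : ℝ) / Real.sqrt m.normSq)) ^ 2)
      ≤ Real.sqrt ((6 / 25) ^ 2) := Real.sqrt_le_sqrt (hdev i)
    _ = 6 / 25 := by rw [Real.sqrt_sq]; norm_num

/-! ### The main wrapper -/

/-- **From the certified check to labelled closeness.**  For a well-formed model with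
`normSq > 0` whose cells are all certified and cover both charts, every labelled configuration
of unit vectors with all pairs `≤ chiR`, bonded pairs `≥ cbloR` and non-bonded pairs `≤ cnbR` is,
label by label, within `6/25` of a linear isometric image of the pattern. -/
theorem close_of_checkAll {m : Model} (hW : m.WF) (hN : 0 < m.normSq) {cells : List Cell}
    (hchk : checkAll m cells = true) (p : Fin 12 → EuclideanSpace ℝ (Fin 3)) (hp1 : ∀ i, ‖p i‖ = 1)
    (hall : ∀ i j, i ≠ j → ⟪p i, p j⟫ ≤ chiR)
    (hbond : ∀ i j, i ≠ j → m.bond i j = true → cbloR ≤ ⟪p i, p j⟫)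
    (hnb : ∀ i j, i ≠ j → m.bond i j = false → ⟪p i, p j⟫ ≤ cnbR) :
    ∃ A : EuclideanSpace ℝ (Fin 3) →ₗᵢ[ℝ] EuclideanSpace ℝ (Fin 3),
      ∀ i, dist (p i) (A (patPt m i)) ≤ 6 / 25 := by
  unfold checkAll at hchk
  simp only [Bool.and_eq_true, List.all_eq_true] at hchk
  obtain ⟨⟨hcovT, hcovF⟩, hall'⟩ := hchk
  have hon := frame_orthonormal hW hp1 hall hbond
  set X := coords m p with hXdef
  have hF : Feasible m.bond X := feasible_coords hW hp1 hall hbond hnb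
  obtain ⟨hX0, hX1y, hX1x, hX2y⟩ := coords_frame_pts hW hp1 hall hbond
  -- the chart and the cell of the free point
  have hy := abs_coords_le_one hp1 hon m.free 1
  rw [abs_le] at hy
  have key : ∀ xp : Bool, coversChart cells xp = true →
      (if xp then 0 ≤ X m.free 0 else X m.free 0 ≤ 0) →
      ∃ A : EuclideanSpace ℝ (Fin 3) →ₗᵢ[ℝ] EuclideanSpace ℝ (Fin 3),
      ∀ i, dist (p i) (A (patPt m i)) ≤ 6 / 25 := by
    intro xp hcov hsign
    obtain ⟨c, hc, hcx, htlo, hthi⟩ := coversChart_sound hcov (X m.free 1) hy.1 hy.2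
    have hcell : runCell m c = true := hall' c hc
    have hIn : InCell m c X := ⟨hX0, hX1y, hX1x, hX2y, htlo, hthi, by rw [hcx]; exact hsign⟩
    have hC : CloseTo m X := runCell_sound hW hN hcell hF hIn
    exact isometry_of_closeTo (frameBasis hon) X (repr_eq_coords hon) hC
  rcases le_or_gt 0 (X m.free 0) with h0 | h0
  · exact key true hcovT (by simpa using h0)
  · exact key false hcovF (by simpa using h0.le)

/-! ### Labelled rigidity from the two checks -/

/-- The FCC model is well formed. -/
theorem fccModel_WF : fccModel.WF := by constructor <;> decide

/-- The HCP model is well formed. -/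
theorem hcpModel_WF : hcpModel.WF := by constructor <;> decide

/-- Every FCC pattern point is a `patPt fccModel i`. -/
theorem exists_patPt_of_mem_fcc {q : EuclideanSpace ℝ (Fin 3)} (hq : q ∈ fccKissingPattern) :
    ∃ i, q = patPt fccModel i := by
  rw [fccKissingPattern, scaledPattern, fccInt_eq_image, Finset.image_image, Finset.mem_image] at hq
  obtain ⟨i, _, rfl⟩ := hq
  exact ⟨i, rfl⟩

/-- Every HCP pattern point is a `patPt hcpModel i`. -/
theorem exists_patPt_of_mem_hcp {q : EuclideanSpace ℝ (Fin 3)} (hq : q ∈ hcpKissingPattern) :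
    ∃ i, q = patPt hcpModel i := by
  rw [hcpKissingPattern, scaledPattern, hcpInt_eq_image, Finset.image_image, Finset.mem_image] at hq
  obtain ⟨i, _, rfl⟩ := hq
  exact ⟨i, rfl⟩

/-- The one-percent upper level is `chiR`. -/
theorem chiR_eq : (1 : ℝ) - 1 / (2 * (101 / 100 : ℝ) ^ 2) = chiR := by rw [chiR]; norm_num

/-- The one-percent lower bond level is `cbloR`. -/
theorem cbloR_eq : (1 : ℝ) - (101 / 100 : ℝ) ^ 2 / 2 = cbloR := by rw [cbloR]; norm_num

/-- **FCC labelled closeness** from the certified check. -/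
theorem labelled_close_fcc {cells : List Cell} (hchk : checkAll fccModel cells = true)
    (p : Fin 12 → EuclideanSpace ℝ (Fin 3)) (hp1 : ∀ i, ‖p i‖ = 1)
    (hall : ∀ i j, i ≠ j → ⟪p i, p j⟫ ≤ 1 - 1 / (2 * (101 / 100 : ℝ) ^ 2))
    (hblo : ∀ i j, fccAdj i j → 1 - (101 / 100 : ℝ) ^ 2 / 2 ≤ ⟪p i, p j⟫)
    (hnb : ∀ i j, i ≠ j → ¬ fccAdj i j → ⟪p i, p j⟫ < 101 / 200) :
    ∃ A : EuclideanSpace ℝ (Fin 3) →ₗᵢ[ℝ] EuclideanSpace ℝ (Fin 3),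
      ∀ q ∈ fccKissingPattern, ∃ i, dist (p i) (A q) ≤ 6 / 25 := by
  obtain ⟨A, hA⟩ := close_of_checkAll fccModel_WF (by decide) hchk p hp1
    (fun i j hij => chiR_eq ▸ hall i j hij)
    (fun i j _ hb => by
      have hadj : fccAdj i j := by simpa [fccModel] using hb
      exact cbloR_eq ▸ hblo i j hadj)
    (fun i j hij hb => by
      have hadj : ¬ fccAdj i j := by simpa [fccModel] using hb
      have h := hnb i j hij hadj
      rw [cnbR]; exact h.le)
  refine ⟨A, fun q hq => ?_⟩
  obtain ⟨i, rfl⟩ := exists_patPt_of_mem_fcc hq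
  exact ⟨i, hA i⟩

/-- **HCP labelled closeness** from the certified check. -/
theorem labelled_close_hcp {cells : List Cell} (hchk : checkAll hcpModel cells = true)
    (p : Fin 12 → EuclideanSpace ℝ (Fin 3)) (hp1 : ∀ i, ‖p i‖ = 1)
    (hall : ∀ i j, i ≠ j → ⟪p i, p j⟫ ≤ 1 - 1 / (2 * (101 / 100 : ℝ) ^ 2))
    (hblo : ∀ i j, hcpAdj i j → 1 - (101 / 100 : ℝ) ^ 2 / 2 ≤ ⟪p i, p j⟫)
    (hnb : ∀ i j, i ≠ j → ¬ hcpAdj i j → ⟪p i, p j⟫ < 101 / 200) :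
    ∃ A : EuclideanSpace ℝ (Fin 3) →ₗᵢ[ℝ] EuclideanSpace ℝ (Fin 3),
      ∀ q ∈ hcpKissingPattern, ∃ i, dist (p i) (A q) ≤ 6 / 25 := by
  obtain ⟨A, hA⟩ := close_of_checkAll hcpModel_WF (by decide) hchk p hp1
    (fun i j hij => chiR_eq ▸ hall i j hij)
    (fun i j _ hb => by
      have hadj : hcpAdj i j := by simpa [hcpModel] using hb
      exact cbloR_eq ▸ hblo i j hadj)
    (fun i j hij hb => by
      have hadj : ¬ hcpAdj i j := by simpa [hcpModel] using hb
      have h := hnb i j hij hadj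
      rw [cnbR]; exact h.le)
  refine ⟨A, fun q hq => ?_⟩
  obtain ⟨i, rfl⟩ := exists_patPt_of_mem_hcp hq
  exact ⟨i, hA i⟩

/-- **Labelled rigidity at `δ = 6/25` from the two certified checks.** -/
theorem labelledRigidity_of_checkAll {cf ch : List Cell} (hf : checkAll fccModel cf = true)
    (hh : checkAll hcpModel ch = true) : LabelledRigidity (6 / 25) :=
  ⟨fun p hp1 hall hblo hnb => labelled_close_fcc hf p hp1 hall hblo hnb,
   fun p hp1 hall hblo hnb => labelled_close_hcp hh p hp1 hall hblo hnb⟩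

end Rig

end Summit.AtomisticToContinuum.Crystallization.Theorems
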